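/-
Copyright (c) 2026 the pub-hodgecm-mathlib formalisation cell (harness21).  Prover fan seat hodgecm-mathlib-LH7-p05 (g3) (F0 ∕ P3c ∕ LH7, lent to
Track B «K2-LIT»), hLiu418 = `stmt-HodgeConjecture-24832`; K1a DESK WORD #26 (K2Liu-p01 (g11)).  THEOREMS ONLY (no `def`, no instance, no notation, no
named-fact hypothesis, no `sorry`); lane `--supports stmt-HodgeConjecture-24832 --as helper`.
-/
import Summits.HodgeConjecture.HodgeConjecture.Theorems.K2LiuKindOneSingularCornerTranslateReading   -- ★ p865024 (LH4-p17): §1 algebra, §2 `hpw_of_leviFrame` shape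
import Literature.NumberTheory.Automorphic.AdelicHeightGLProofs                                     -- ★ `adelicHeightGL_nonneg`
import HarnessLib

/-!
# Crux `HLiu418`, socket #41, KIND 1 a♮ — (b↑) + SHIFT: `K2LiuKindOneSingularCornerTranslateCeiling` — the prefactor dictionary's letter `hpw_le` (★ p864983 (v-β)) from
# the Levi-frame letter and a height CEILING on `Im(Fr(h_∞)·i1)`; and the Levi-frame ∕ `U(J)` letters at the SHIFTED frame `x ↦ Fr (x·g𝒦)`

Cell `hodgecm-mathlib`, hLiu418 = `stmt-HodgeConjecture-24832` (helper lane, count-neutral); squad K2 ∕ K2Liu, road `K2_Liu`, KIND 1 a♮; K1a desk K2Liu-p01 (g11) WORD #26.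
§1 **`hpw_le_of_ceiling`.**  With ★ p865024's by-value Levi-frame letters (`hFrL hLevi` at a generic tube frame `Fr ∈ U(J)`), a frame `a` READ by `haW : (aᴴWa)₀₀ = W₁₁`, the
Gaussian parameter `pw` read as ★ p864004's exponent at the translate (`hpw_eq`), a CEILING `hceil : Re⟨v, V(Fr(h_∞) w′) v⟩ ≤ CV·‖h‖²·Σ‖v_k‖²` (★ p865050 `im_moeb_frame_ceiling_on`
shape) and uniform bounds `‖c_{w′} 1‖, ‖c′_{w′} k‖ ≤ Rc`: `pw X h w′ ≤ CP·‖h‖²·Σ_k ‖ι_{w′} γ̂_{1k}‖²` with `CP := 2·Rc²·Rc²·CV` — ★ p864983's (b↑) binder at `bP := 2`.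
(`pw = 2‖c₁‖²·Re⟨Γ₁, (D′V D′ᴴ)ᵀΓ₁⟩` by ★ p865024 §1–§2; transpose = conjugate test vector; `⟨u, D′VD′ᴴu⟩ = ⟨D′ᴴu, V D′ᴴu⟩`; ceiling; `‖c̄′_k ū_k‖² = ‖c′_k‖²‖u_k‖²`.)
§2 **`hFrL_shift`, `hFrU_shift`** (WORD #25 (ii)): for a multiplicative frame (`hmul`, ★ `frame_mul` shape) the Levi-frame letter and the `U(J)` letter pass to the shifted
frame `x ↦ Fr (x·g𝒦)` (the record's right frame carries the compact conjugator `g𝒦`).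
[Shimura1997, §6.3–6.4, §18.1], [KudlaRallis1994, §2 (2.10)–(2.12)].
HONEST LABEL.  Elementary, count-neutral; closes no socket: `HC_CM` is proved only modulo the 7 printed citations (2 remaining named inputs: hLiu418 =
`stmt-HodgeConjecture-24832`, h413 = `stmt-HodgeConjecture-24833`) until rung 0 closes.
-/

set_option autoImplicit false
set_option linter.dupNamespace false -- the mandated namespace repeats `HodgeConjecture.HodgeConjecture`

noncomputable section

open scoped Matrix ComplexConjugate
open Complex Matrix NumberField NumberField.InfinitePlace IsDedekindDomain
open Literature.NumberTheory.ModularForms.SiegelUpperHalfSpace (moeb)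
open Literature.NumberTheory.Automorphic Literature.NumberTheory.Automorphic.UnitaryGroup Literature.NumberTheory.GaloisRepresentations
open Literature.NumberTheory.GelbartRogawski1991 Literature.NumberTheory.GelbartRogawski1991.GRConstruction

namespace Summit.HodgeConjecture.HodgeConjecture.Cruxes.HLiu418.K2LiuKindOneSingularCornerTranslateCeiling

open K2LiuSiegelUnipotentFourierDefs
open K2LiuKindOneSingularCornerTranslateReading (im_moeb_base_levi_mul levi_conj_apply_same re_dotProduct_smul_mulVec dotProduct_transpose_mulVec_eq
  dotProduct_diagonal_conj_mulVec norm_conj_mul_star_sq)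

variable (L : Type) [Field L] [NumberField L] [IsCMField L] {N M : ℕ} (e : Fin N × Fin M ≃ Fin 2)
  (dV : Fin N → L) (hdV : ∀ i, IsCMField.complexConj L (dV i) = dV i)
  (dW : Fin M → L) (hdW : ∀ i, IsCMField.complexConj L (dW i) = dW i)

/-! ## §1 (b↑): `pw ≤ CP·‖h‖²·Σ‖ι γ̂_{1k}‖²` from the Levi-frame letter and the ceiling -/

/-- **(b↑) `hpw_le` FROM THE CEILING.**  ★ p864983's prefactor-dictionary letter (b↑) at `bP := 2`: `∃ CP ≥ 0, pw X h w′ ≤ CP·‖h‖^2·Σ_k ‖ι_{w′}γ̂_{1k}‖²`, from ★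
p865024's Levi-frame letters `hFrL hLevi`, the frame reading `haW`, the exponent reading `hpw_eq`, the ceiling `hceil` on `Im(Fr(h_∞)·i1)` (★ p865050) and uniform
bounds on `c, c′`.  `CP := 2·Rc²·Rc²·CV`. [cite: Shimura1997, §6.3–6.4, §18.1] [cite: KudlaRallis1994, §2 (2.10)–(2.12)] -/
theorem hpw_le_of_ceiling (Tinf : Finset (InfinitePlace L))
    (γ : Projectivization L (Fin 2 → L) → GL (Fin 2) L)
    (w : skewMatrices ((IsCMField.complexConj L : L ≃ₐ[Fp L] L) : L →+* L) ((gramR L e dV hdV dW hdW).map (algebraMap (Fp L) L)) → Fin 2 → L)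
    (hw : ∀ S, w S ≠ 0)
    (gc : skewMatrices ((IsCMField.complexConj L : L ≃ₐ[Fp L] L) : L →+* L) ((gramR L e dV hdV dW hdW).map (algebraMap (Fp L) L)) → HA L e dV hdV dW hdW)
    (Fr : UnitaryGroup.arch (Fp L) L (IsCMField.complexConj L) (2 + 2) (hermD L e dV hdV dW hdW) → {w : InfinitePlace L // w.IsComplex} →
      Matrix (Fin 2 ⊕ Fin 2) (Fin 2 ⊕ Fin 2) ℂ)
    (hFrU : ∀ (a : UnitaryGroup.arch (Fp L) L (IsCMField.complexConj L) (2 + 2) (hermD L e dV hdV dW hdW)) (w : {w : InfinitePlace L // w.IsComplex}),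
      (Fr a w)ᴴ * Matrix.J (Fin 2) ℂ * Fr a w = Matrix.J (Fin 2) ℂ)
    (c c' : {w : InfinitePlace L // w.IsComplex} → Fin 2 → ℂ)
    (A' : skewMatrices ((IsCMField.complexConj L : L ≃ₐ[Fp L] L) : L →+* L) ((gramR L e dV hdV dW hdW).map (algebraMap (Fp L) L)) →
      {w : InfinitePlace L // w.IsComplex} → Matrix (Fin 2) (Fin 2) ℂ)
    (hFrL : ∀ (X : skewMatrices ((IsCMField.complexConj L : L ≃ₐ[Fp L] L) : L →+* L) ((gramR L e dV hdV dW hdW).map (algebraMap (Fp L) L)))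
      (h : HA L e dV hdV dW hdW) (w' : {w : InfinitePlace L // w.IsComplex}),
      Fr (UnitaryGroup.archPart (Fp L) L (IsCMField.complexConj L) (2 + 2) (hermD L e dV hdV dW hdW) (gc X * h)) w' =
        fromBlocks (diagonal (c w') * ((γ (Projectivization.mk L (w X) (hw X)) : GL (Fin 2) L) : Matrix (Fin 2) (Fin 2) L).map w'.1.embedding * diagonal (c' w'))
          0 0 (A' X w') * Fr (UnitaryGroup.archPart (Fp L) L (IsCMField.complexConj L) (2 + 2) (hermD L e dV hdV dW hdW) h) w')
    (hLevi : ∀ (X : skewMatrices ((IsCMField.complexConj L : L ≃ₐ[Fp L] L) : L →+* L) ((gramR L e dV hdV dW hdW).map (algebraMap (Fp L) L)))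
      (w' : {w : InfinitePlace L // w.IsComplex}),
      (diagonal (c w') * ((γ (Projectivization.mk L (w X) (hw X)) : GL (Fin 2) L) : Matrix (Fin 2) (Fin 2) L).map w'.1.embedding * diagonal (c' w'))ᴴ * A' X w' = 1)
    (a : Matrix (Fin 2) (Fin 2) ℂ) (haW : ∀ W : Matrix (Fin 2) (Fin 2) ℂ, (aᴴ * W * a) 0 0 = W 1 1)
    (pw : skewMatrices ((IsCMField.complexConj L : L ≃ₐ[Fp L] L) : L →+* L) ((gramR L e dV hdV dW hdW).map (algebraMap (Fp L) L)) → HA L e dV hdV dW hdW → InfinitePlace L → ℝ)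
    (hpw_eq : ∀ (X : skewMatrices ((IsCMField.complexConj L : L ≃ₐ[Fp L] L) : L →+* L) ((gramR L e dV hdV dW hdW).map (algebraMap (Fp L) L))) (h : HA L e dV hdV dW hdW) (w' : InfinitePlace L),
      pw X h w' = ((aᴴ * ((2 : ℂ) • ((2 * I)⁻¹ • (moeb (Fr (UnitaryGroup.archPart (Fp L) L (IsCMField.complexConj L) (2 + 2) (hermD L e dV hdV dW hdW) (gc X * h)) ⟨w', IsTotallyComplex.isComplex w'⟩) (I • (1 : Matrix (Fin 2) (Fin 2) ℂ)) -
          (moeb (Fr (UnitaryGroup.archPart (Fp L) L (IsCMField.complexConj L) (2 + 2) (hermD L e dV hdV dW hdW) (gc X * h)) ⟨w', IsTotallyComplex.isComplex w'⟩) (I • (1 : Matrix (Fin 2) (Fin 2) ℂ)))ᴴ))) * a) 0 0).re)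
    {CV Rc : ℝ} (hCV : 0 ≤ CV)
    (hceil : ∀ (h : HA L e dV hdV dW hdW), ∀ w' ∈ Tinf, ∀ v : Fin 2 → ℂ,
      (star v ⬝ᵥ (((2 * I)⁻¹ • (moeb (Fr (UnitaryGroup.archPart (Fp L) L (IsCMField.complexConj L) (2 + 2) (hermD L e dV hdV dW hdW) h) ⟨w', IsTotallyComplex.isComplex w'⟩) (I • (1 : Matrix (Fin 2) (Fin 2) ℂ)) -
          (moeb (Fr (UnitaryGroup.archPart (Fp L) L (IsCMField.complexConj L) (2 + 2) (hermD L e dV hdV dW hdW) h) ⟨w', IsTotallyComplex.isComplex w'⟩) (I • (1 : Matrix (Fin 2) (Fin 2) ℂ)))ᴴ)) *ᵥ v)).re ≤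
        CV * adelicHeightGL (2 + 2) L (h : GL (Fin (2 + 2)) (AdeleRing (𝓞 L) L)) ^ 2 * ∑ k, ‖v k‖ ^ 2)
    (hc : ∀ w' ∈ Tinf, ‖c ⟨w', IsTotallyComplex.isComplex w'⟩ 1‖ ≤ Rc) (hc' : ∀ w' ∈ Tinf, ∀ k, ‖c' ⟨w', IsTotallyComplex.isComplex w'⟩ k‖ ≤ Rc) :
    ∃ CP : ℝ, 0 ≤ CP ∧ ∀ (X : skewMatrices ((IsCMField.complexConj L : L ≃ₐ[Fp L] L) : L →+* L) ((gramR L e dV hdV dW hdW).map (algebraMap (Fp L) L))) (h : HA L e dV hdV dW hdW),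
      (X : Matrix (Fin 2) (Fin 2) L) ≠ 0 → (X : Matrix (Fin 2) (Fin 2) L).det = 0 → ∀ w' ∈ Tinf,
        pw X h w' ≤ CP * adelicHeightGL (2 + 2) L (h : GL (Fin (2 + 2)) (AdeleRing (𝓞 L) L)) ^ (2 : ℝ) *
          ∑ k, ‖w'.embedding (((γ (Projectivization.mk L (w X) (hw X)) : GL (Fin 2) L) : Matrix (Fin 2) (Fin 2) L) 1 k)‖ ^ 2 := by
  have hRc : 0 ≤ Rc ^ 2 := sq_nonneg Rc
  refine ⟨2 * Rc ^ 2 * Rc ^ 2 * CV, by positivity, fun X h _ _ w' hw' => ?_⟩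
  set Γ : Matrix (Fin 2) (Fin 2) ℂ := ((γ (Projectivization.mk L (w X) (hw X)) : GL (Fin 2) L) : Matrix (Fin 2) (Fin 2) L).map w'.embedding with hΓ
  have hv : (fun k => w'.embedding (((γ (Projectivization.mk L (w X) (hw X)) : GL (Fin 2) L) : Matrix (Fin 2) (Fin 2) L) 1 k)) = fun k => Γ 1 k := rfl
  have hH : 0 ≤ adelicHeightGL (2 + 2) L (h : GL (Fin (2 + 2)) (AdeleRing (𝓞 L) L)) := adelicHeightGL_nonneg _
  -- ★ p865024 §2's chain: the exponent at the translate IS the twisted pairing `2‖c₁‖²·Re⟨Γ₁, (D′V D′ᴴ)ᵀ Γ₁⟩`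
  have key : (1 : ℝ) * (star (fun k => w'.embedding (((γ (Projectivization.mk L (w X) (hw X)) : GL (Fin 2) L) : Matrix (Fin 2) (Fin 2) L) 1 k)) ⬝ᵥ
      ((((2 * ‖c ⟨w', IsTotallyComplex.isComplex w'⟩ 1‖ ^ 2 : ℝ) : ℂ) •
          (diagonal (c' ⟨w', IsTotallyComplex.isComplex w'⟩) * ((2 * I)⁻¹ • (moeb (Fr (UnitaryGroup.archPart (Fp L) L (IsCMField.complexConj L) (2 + 2) (hermD L e dV hdV dW hdW) h) ⟨w', IsTotallyComplex.isComplex w'⟩) (I • (1 : Matrix (Fin 2) (Fin 2) ℂ)) -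
          (moeb (Fr (UnitaryGroup.archPart (Fp L) L (IsCMField.complexConj L) (2 + 2) (hermD L e dV hdV dW hdW) h) ⟨w', IsTotallyComplex.isComplex w'⟩) (I • (1 : Matrix (Fin 2) (Fin 2) ℂ)))ᴴ)) * (diagonal (c' ⟨w', IsTotallyComplex.isComplex w'⟩))ᴴ)ᵀ) *ᵥ
        fun k => w'.embedding (((γ (Projectivization.mk L (w X) (hw X)) : GL (Fin 2) L) : Matrix (Fin 2) (Fin 2) L) 1 k))).re = pw X h w' := by
    rw [hpw_eq, one_mul, hv, re_dotProduct_smul_mulVec, haW, hFrL X h ⟨w', IsTotallyComplex.isComplex w'⟩,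
      im_moeb_base_levi_mul (hLevi X ⟨w', IsTotallyComplex.isComplex w'⟩) (hFrU (UnitaryGroup.archPart (Fp L) L (IsCMField.complexConj L) (2 + 2) (hermD L e dV hdV dW hdW) h) ⟨w', IsTotallyComplex.isComplex w'⟩),
      Matrix.smul_apply, smul_eq_mul, show (⟨w', IsTotallyComplex.isComplex w'⟩ : {w : InfinitePlace L // w.IsComplex}).1.embedding = w'.embedding from rfl, ← hΓ, levi_conj_apply_same, Complex.mul_conj,
      Complex.normSq_eq_norm_sq]
    simp only [Complex.mul_re, Complex.ofReal_re, Complex.ofReal_im, zero_mul, sub_zero, Complex.re_ofNat, Complex.im_ofNat]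
    ring
  -- the ceiling at the conjugated test vector
  have hQ := hceil h w' hw' (fun k => (starRingEnd ℂ) (c' ⟨w', IsTotallyComplex.isComplex w'⟩ k) * (star fun k => w'.embedding (((γ (Projectivization.mk L (w X) (hw X)) : GL (Fin 2) L) : Matrix (Fin 2) (Fin 2) L) 1 k)) k)
  have hterm : ∀ k, ‖(starRingEnd ℂ) (c' ⟨w', IsTotallyComplex.isComplex w'⟩ k) * (star fun k => w'.embedding (((γ (Projectivization.mk L (w X) (hw X)) : GL (Fin 2) L) : Matrix (Fin 2) (Fin 2) L) 1 k)) k‖ ^ 2 ≤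
      Rc ^ 2 * ‖w'.embedding (((γ (Projectivization.mk L (w X) (hw X)) : GL (Fin 2) L) : Matrix (Fin 2) (Fin 2) L) 1 k)‖ ^ 2 := fun k => by
    rw [Pi.star_apply, norm_conj_mul_star_sq]
    exact mul_le_mul_of_nonneg_right (pow_le_pow_left₀ (norm_nonneg _) (hc' w' hw' k) 2) (sq_nonneg _)
  have hS : ∑ k, ‖(starRingEnd ℂ) (c' ⟨w', IsTotallyComplex.isComplex w'⟩ k) * (star fun k => w'.embedding (((γ (Projectivization.mk L (w X) (hw X)) : GL (Fin 2) L) : Matrix (Fin 2) (Fin 2) L) 1 k)) k‖ ^ 2 ≤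
      Rc ^ 2 * ∑ k, ‖w'.embedding (((γ (Projectivization.mk L (w X) (hw X)) : GL (Fin 2) L) : Matrix (Fin 2) (Fin 2) L) 1 k)‖ ^ 2 := by
    rw [Finset.mul_sum]; exact Finset.sum_le_sum fun k _ => hterm k
  have hc1 : ‖c ⟨w', IsTotallyComplex.isComplex w'⟩ 1‖ ^ 2 ≤ Rc ^ 2 := pow_le_pow_left₀ (norm_nonneg _) (hc w' hw') 2
  have hSum0 : 0 ≤ ∑ k, ‖w'.embedding (((γ (Projectivization.mk L (w X) (hw X)) : GL (Fin 2) L) : Matrix (Fin 2) (Fin 2) L) 1 k)‖ ^ 2 := Finset.sum_nonneg fun k _ => sq_nonneg _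
  have hY : 0 ≤ CV * adelicHeightGL (2 + 2) L (h : GL (Fin (2 + 2)) (AdeleRing (𝓞 L) L)) ^ 2 * (Rc ^ 2 * ∑ k, ‖w'.embedding (((γ (Projectivization.mk L (w X) (hw X)) : GL (Fin 2) L) : Matrix (Fin 2) (Fin 2) L) 1 k)‖ ^ 2) := by
    positivity
  rw [← key, one_mul, re_dotProduct_smul_mulVec, dotProduct_transpose_mulVec_eq, dotProduct_diagonal_conj_mulVec, Real.rpow_two]
  calc 2 * ‖c ⟨w', IsTotallyComplex.isComplex w'⟩ 1‖ ^ 2 * _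
      ≤ 2 * ‖c ⟨w', IsTotallyComplex.isComplex w'⟩ 1‖ ^ 2 * (CV * adelicHeightGL (2 + 2) L (h : GL (Fin (2 + 2)) (AdeleRing (𝓞 L) L)) ^ 2 *
          (Rc ^ 2 * ∑ k, ‖w'.embedding (((γ (Projectivization.mk L (w X) (hw X)) : GL (Fin 2) L) : Matrix (Fin 2) (Fin 2) L) 1 k)‖ ^ 2)) :=
        mul_le_mul_of_nonneg_left (hQ.trans (mul_le_mul_of_nonneg_left hS (by positivity))) (by positivity)
    _ ≤ 2 * Rc ^ 2 * (CV * adelicHeightGL (2 + 2) L (h : GL (Fin (2 + 2)) (AdeleRing (𝓞 L) L)) ^ 2 *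
          (Rc ^ 2 * ∑ k, ‖w'.embedding (((γ (Projectivization.mk L (w X) (hw X)) : GL (Fin 2) L) : Matrix (Fin 2) (Fin 2) L) 1 k)‖ ^ 2)) :=
        mul_le_mul_of_nonneg_right (mul_le_mul_of_nonneg_left hc1 two_pos.le) hY
    _ = 2 * Rc ^ 2 * Rc ^ 2 * CV * adelicHeightGL (2 + 2) L (h : GL (Fin (2 + 2)) (AdeleRing (𝓞 L) L)) ^ 2 *
          ∑ k, ‖w'.embedding (((γ (Projectivization.mk L (w X) (hw X)) : GL (Fin 2) L) : Matrix (Fin 2) (Fin 2) L) 1 k)‖ ^ 2 := by ring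


/-! ## §2 SHIFT: the Levi-frame and `U(J)` letters at the shifted frame `x ↦ Fr (x·g𝒦)` -/

/-- **THE LEVI-FRAME LETTER AT THE SHIFTED FRAME.**  If `Fr` is multiplicative (`hmul`, ★ `frame_mul`) and satisfies ★ p865024's Levi-frame letter `hFrL`, then so does
the shifted frame `x ↦ Fr (x·g𝒦)` (same Levi block `A′`). [cite: Shimura1997, §18.1] -/
theorem hFrL_shift
    (γ : Projectivization L (Fin 2 → L) → GL (Fin 2) L)
    (w : skewMatrices ((IsCMField.complexConj L : L ≃ₐ[Fp L] L) : L →+* L) ((gramR L e dV hdV dW hdW).map (algebraMap (Fp L) L)) → Fin 2 → L)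
    (hw : ∀ S, w S ≠ 0)
    (gc : skewMatrices ((IsCMField.complexConj L : L ≃ₐ[Fp L] L) : L →+* L) ((gramR L e dV hdV dW hdW).map (algebraMap (Fp L) L)) → HA L e dV hdV dW hdW)
    (Fr : UnitaryGroup.arch (Fp L) L (IsCMField.complexConj L) (2 + 2) (hermD L e dV hdV dW hdW) → {w : InfinitePlace L // w.IsComplex} →
      Matrix (Fin 2 ⊕ Fin 2) (Fin 2 ⊕ Fin 2) ℂ)
    (c c' : {w : InfinitePlace L // w.IsComplex} → Fin 2 → ℂ)
    (A' : skewMatrices ((IsCMField.complexConj L : L ≃ₐ[Fp L] L) : L →+* L) ((gramR L e dV hdV dW hdW).map (algebraMap (Fp L) L)) →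
      {w : InfinitePlace L // w.IsComplex} → Matrix (Fin 2) (Fin 2) ℂ)
    (hmul : ∀ (x y : UnitaryGroup.arch (Fp L) L (IsCMField.complexConj L) (2 + 2) (hermD L e dV hdV dW hdW)) (w' : {w : InfinitePlace L // w.IsComplex}), Fr (x * y) w' = Fr x w' * Fr y w')
    (g𝒦 : UnitaryGroup.arch (Fp L) L (IsCMField.complexConj L) (2 + 2) (hermD L e dV hdV dW hdW))
    (hFrL : ∀ (X : skewMatrices ((IsCMField.complexConj L : L ≃ₐ[Fp L] L) : L →+* L) ((gramR L e dV hdV dW hdW).map (algebraMap (Fp L) L)))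
      (h : HA L e dV hdV dW hdW) (w' : {w : InfinitePlace L // w.IsComplex}),
      Fr (UnitaryGroup.archPart (Fp L) L (IsCMField.complexConj L) (2 + 2) (hermD L e dV hdV dW hdW) (gc X * h)) w' =
        fromBlocks (diagonal (c w') * ((γ (Projectivization.mk L (w X) (hw X)) : GL (Fin 2) L) : Matrix (Fin 2) (Fin 2) L).map w'.1.embedding * diagonal (c' w'))
          0 0 (A' X w') * Fr (UnitaryGroup.archPart (Fp L) L (IsCMField.complexConj L) (2 + 2) (hermD L e dV hdV dW hdW) h) w') :
    ∀ (X : skewMatrices ((IsCMField.complexConj L : L ≃ₐ[Fp L] L) : L →+* L) ((gramR L e dV hdV dW hdW).map (algebraMap (Fp L) L)))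
      (h : HA L e dV hdV dW hdW) (w' : {w : InfinitePlace L // w.IsComplex}),
      Fr (UnitaryGroup.archPart (Fp L) L (IsCMField.complexConj L) (2 + 2) (hermD L e dV hdV dW hdW) (gc X * h) * g𝒦) w' =
        fromBlocks (diagonal (c w') * ((γ (Projectivization.mk L (w X) (hw X)) : GL (Fin 2) L) : Matrix (Fin 2) (Fin 2) L).map w'.1.embedding * diagonal (c' w'))
          0 0 (A' X w') * Fr (UnitaryGroup.archPart (Fp L) L (IsCMField.complexConj L) (2 + 2) (hermD L e dV hdV dW hdW) h * g𝒦) w' :=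
  fun X h w' => by rw [hmul, hmul, hFrL X h w', Matrix.mul_assoc]

/-- **THE `U(J)` LETTER AT THE SHIFTED FRAME** (`(Fr(x·g𝒦))ᴴ J Fr(x·g𝒦) = J`). [cite: Shimura1997, §6.3] -/
theorem hFrU_shift
    (Fr : UnitaryGroup.arch (Fp L) L (IsCMField.complexConj L) (2 + 2) (hermD L e dV hdV dW hdW) → {w : InfinitePlace L // w.IsComplex} →
      Matrix (Fin 2 ⊕ Fin 2) (Fin 2 ⊕ Fin 2) ℂ)
    (hFrU : ∀ (a : UnitaryGroup.arch (Fp L) L (IsCMField.complexConj L) (2 + 2) (hermD L e dV hdV dW hdW)) (w : {w : InfinitePlace L // w.IsComplex}),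
      (Fr a w)ᴴ * Matrix.J (Fin 2) ℂ * Fr a w = Matrix.J (Fin 2) ℂ)
    (g𝒦 : UnitaryGroup.arch (Fp L) L (IsCMField.complexConj L) (2 + 2) (hermD L e dV hdV dW hdW)) :
    ∀ (x : UnitaryGroup.arch (Fp L) L (IsCMField.complexConj L) (2 + 2) (hermD L e dV hdV dW hdW)) (w : {w : InfinitePlace L // w.IsComplex}),
      (Fr (x * g𝒦) w)ᴴ * Matrix.J (Fin 2) ℂ * Fr (x * g𝒦) w = Matrix.J (Fin 2) ℂ :=
  fun x w => hFrU (x * g𝒦) w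

end Summit.HodgeConjecture.HodgeConjecture.Cruxes.HLiu418.K2LiuKindOneSingularCornerTranslateCeiling

end
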